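import Mathlib
import Literature.MathematicalPhysics.QuantumFieldTheory.Balaban1983to89.B6QGGQInvTowerTorus
import Literature.MathematicalPhysics.QuantumFieldTheory.Balaban1983to89.B6Eq239Commutator
import Literature.MathematicalPhysics.QuantumFieldTheory.Balaban1983to89.B6TorusCutoffChi
import Literature.MathematicalPhysics.QuantumFieldTheory.Balaban1983to89.B6RandomWalk
import Literature.MathematicalPhysics.QuantumFieldTheory.Balaban1983to89.B5G0BridgeP12

/-!
# `Balaban1983to89.B6Commutator244TowerTorus` — T. Bałaban, *Propagators and renormalization transformations for lattice gauge theories. II*,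
Commun. Math. Phys. **96** (1984) 223–250 [Balaban1984PropagatorsII]: **the commutator `K(χ) = χΔ′_a − Δ′_aχ` of (2.38)/(2.39) and its size (2.44)
`O(M⁻¹)e^{−δ₀d}`, GENUINE, on the fine torus `T_η = Site P 0` of the one-scale tower-torus family** (`Δ′_a = −Δ^η + m² + a_KQ′_K*Q′_K`,
`G′ = Δ′_a⁻¹ = (B1RG242Torus.tower P a m²).G K`, every `K ≥ 1`, mesh `η = L^{−K}`), for the smooth scale-`M` cut-off `χ` of `…B6TorusCutoffChi`,
stated in the (2.51) majorant currency `B6RandomWalk.HasMajorant` of the cell's random-walk files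

statement-level skeleton of published theorems with citation tags; proofs where landed; nothing here is a claim about the Yang–Mills mass gap

Phase-2 PROOF SEAT p01 (gen 8) of the cell `lit-balaban` (HOME `run/shared/lean/pub/lit-balaban/`), free-target protocol G.5-34(d), own lane;
file 3 of the programme «the MODIFIED prescription of (2.70) with `G′(□̃)` on the torus `T_□̃` and the p. 238 change-of-domain sentence,
genuine»: this file supplies the located inputs `hG`, `hKG` (and the pointwise commutator bound that the transplant file reuses for `hGw`, `hKGw`)
of the b2b line-3 chain `B6Prop23DomainInput.hdom_of_line3` FOR THE GENUINE OPERATORS.  Sources read as page images: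
`run/shared/lean/pub/pub-balaban/b2b-balaban-ref1/pages/1984-cmp96-propagators-rt-II/1984-cmp96-propagators-rt-II-p007-x2.png` (p. 229),
`…-p008-x2.png` (p. 230), `…-p016-x2.png` (p. 238); journal page = PDF page + 222.

THE PRINTED TEXT.  p. 229 [PDF 7]: *"Δ′_aG′₀ = I − Σ_□ K(h_□)G′(□)h_□ = I − R, (2.38) where (K(h)λ)(x) = Σ_{b∈st(x)} (∂h)(b)(∂λ)(b) −
(Δh)(x)λ(x) − a_j(L^jη)^{−2} Σ_{x′∈B^j(y^j(x))} L^{−jd}(∂h)(Γ^{(j)}_{x,y^j(x),x′})λ(x′) if x ∈ B^j(Λ_j). (2.39) The derivatives above are on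
η-scale."*  p. 230 [PDF 8]: *"|(G′(□)λ)(x)|, |(∂^{L^{−j}}_μG′(□)λ)(x)| ≤ O(1)e^{−δ₀dist(x, supp λ)}|λ|. (2.43) This inequality and (2.40) imply
|(K(h_□)G′(□)h_□λ)(x)| ≤ O(M^{−1})e^{−δ₀|x−y|}|λ| (2.44)"*.  p. 238 [PDF 16]: *"An estimate of the terms with the commutator is even simpler
and gives a factor O(M^{−1})."*

WHAT THIS FILE PROVES (kernel-checked, 0 sorry, axioms standard), block map `blk P K : Site P 0 → Site P K`:
* §3 `Δ′_a`, `G′` as endomorphisms (`Dop`, `Gop`; `Gop * Dop = 1`, `Dop * Gop = 1`), the pointwise formula `(Δ′_af)(x) = m²f(x) + (Δf)(x) +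
  a_KL^{−Kd}Σ_{B(x)}f` (`Dop_apply`, in the vocabulary of r03's `B6Eq239Commutator.deltaPrimeA`), and **(2.67)₁,₂ IN THE (2.51) MAJORANT
  CURRENCY**: `HasMajorant blk G′ (C·e^{−½δ₀|y−y′|₁})` and `|(∂^η_μG′f)(x)| ≤ Ce^{−½δ₀|blk x−y′|₁}B` (`majorants_G`), from this seat's gen-6
  `B6Prop22OneScaleTorus.entries_oneScaleTorus` — ONE pair `(δ₀, C)` for the whole family `Index d L`.
* §4 **(2.39)/(2.44) GENUINE**: the pointwise commutator identity for `Δ′_a` (`comm_apply`, = r03's `eq239` read on `Dop`), the pointwise size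
  `|(χΔ′_ag − Δ′_a(χg))(x)| ≤ (dD1θ/M)A′ + (dD2θ/(4M²) + adD1θ/(2M))A` from local sup bounds `A` on `g` and `A′` on `∇^ηg` near `x`
  (`abs_comm_apply_le`; with the explicit zone constant `theta0` = `C·e^{δ₀/2}·(dD1θ + dD2θ/4 + adD1θ/2) + 1`: `abs_comm_apply_le_theta0`),
  its vanishing on the core (`comm_apply_eq_zero_of_core`) and far from the support (`comm_apply_eq_zero_of_vanish`), and
  **`hasMajorant_comm_G`**: `HasMajorant blk ((χΔ′_a − Δ′_aχ)·G′) (1_N(y)·(θ₀/M)·e^{−½δ₀|y−y′|₁})`, `θ₀ = theta0 d a C δ₀`, `N` = the complement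
  of the core — the (2.44)-shape *"O(M⁻¹)e^{−δ₀|x−y|}"* for the genuine `G′`, every `K ≥ 1`, every volume, uniformly, packaged with (i)
  (the sibling `…B6TransplantMajorants` proves the same majorant, same `θ₀`, for the local inverse `G′(□̃)`).

HONEST SCOPE ∕ NOT CLAIMED.  (a) The print's (2.44) is about `K(h_□)G′(□)h_□` with the LOCAL inverse `G′(□)`; this file proves the same
computation («(2.43) and (2.40) imply (2.44)») for the GLOBAL `G′` (its (2.43) = Proposition 2.2 on one scale) and, pointwise, for any `g` with
local sup/gradient bounds — the transplant sibling feeds the transplanted small-torus `G′(□̃)` through the same lemma.  (b) One scale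
(`L^jη = 1`), scalar model, `m² ≥ 0`, `a > 0`; constants existential (functions of `d, L, a, m²` and `D1θ`, `D2θ`).  Value = located inputs of
the p. 238 change-of-domain estimate for the genuine operators (consumed by the siblings), NOT summit progress.
-/

namespace Literature.MathematicalPhysics.QuantumFieldTheory.Balaban1983to89.B6Commutator244TowerTorus

open Finset Matrix
open B1RG242Torus (tower Qk Qks hOp deriv deriv_mulVec hOp_mulVec Qk_mulVec Qks_mulVec shiftMat lvl lvl_of_le
  sitesPerDir_zero_eq)
open B5Ineq137Torus (blk blk_val fine fine_val toT Nv Nv_pos supN le_supN supN_nonneg)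
open B5GpSettingTorus (supNormV dir0)
open B6Prop22OneScaleTorus (T1 Index blockSup le_blockSup entryB entryB_zero_top entryB_one_top entries_oneScaleTorus)
open B6Lemma21TowerTorus (T1_triangle T1_symm T1_nonneg)
open B6QGGQInvTowerTorus (deltaPrimeK wQ wQ_pos G_mul_deltaPrimeK deltaPrimeK_mul_G)
open B4PartitionUnity22 (thetaProf D1 D2 contDiff_thetaProf hasCompactSupport_thetaProf D1_nonneg D2_nonneg)
open LatticeFieldCalculus (laplace grad pdiff)
open B6Eq239Commutator (blockAvgOp deltaPrimeA eq239)
open B6RandomWalk (HasMajorant BlockSupp)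
open B6Expansion282 (mulOp mulOp_apply)
open B6TorusWindowChart
open B10StarCount (shift_unshift unshift_shift)
open B6TorusCutoffChi
open B5G0BridgeP12 (derivT_mulVec)

noncomputable section

variable (P : Params)

variable {P}

/-! ## §3  `Δ′_a`, `G′ = Δ′_a⁻¹` as endomorphisms of the functions on `T_η`, and (2.67)₁,₂ in the (2.51) majorant currency -/

section Operators

variable (P)

/-- **`Δ′_a = −Δ^η + m² + a_KQ′_K*Q′_K`** ((2.13) on one scale) as an endomorphism of the real functions on the fine torus `Site P 0`
(the matrix `B6QGGQInvTowerTorus.deltaPrimeK` through `Matrix.toLin'`). [cite: Balaban1984PropagatorsII, (2.13) p.225] -/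
def Dop (a msq : ℝ) : Module.End ℝ (Site P 0 → ℝ) := Matrix.toLin' (deltaPrimeK P a msq)

/-- **`G′ = Δ′_a⁻¹`** (= `(B1RG242Torus.tower P a m²).G K`, Prop. 2.2's operator on one scale) as an endomorphism.
[cite: Balaban1984PropagatorsII, (2.17) p.225, Prop. 2.2 p.234] -/
def Gop (a msq : ℝ) : Module.End ℝ (Site P 0 → ℝ) := Matrix.toLin' ((tower P a msq).G P.K)

variable {P}

/-- `Δ′_a f = deltaPrimeK *ᵥ f`. [cite: Balaban1984PropagatorsII, (2.13) p.225; bookkeeping] -/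
theorem Dop_apply_eq (a msq : ℝ) (f : Site P 0 → ℝ) : Dop P a msq f = deltaPrimeK P a msq *ᵥ f := Matrix.toLin'_apply _ _

/-- `G′ f = G *ᵥ f`. [cite: Balaban1984PropagatorsII, (2.17) p.225; bookkeeping] -/
theorem Gop_apply_eq (a msq : ℝ) (f : Site P 0 → ℝ) : Gop P a msq f = (tower P a msq).G P.K *ᵥ f := Matrix.toLin'_apply _ _

/-- `G′Δ′_a = 1`. [cite: Balaban1984PropagatorsII, (2.17) p.225] -/
theorem Gop_mul_Dop {a msq : ℝ} (ha : 0 < a) (hm : 0 ≤ msq) (hK : 1 ≤ P.K) : Gop P a msq * Dop P a msq = 1 := by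
  rw [Gop, Dop, Module.End.mul_eq_comp, ← Matrix.toLin'_mul, G_mul_deltaPrimeK P ha hm hK, Matrix.toLin'_one,
    Module.End.one_eq_id]

/-- `Δ′_aG′ = 1`. [cite: Balaban1984PropagatorsII, (2.17) p.225] -/
theorem Dop_mul_Gop {a msq : ℝ} (ha : 0 < a) (hm : 0 ≤ msq) (hK : 1 ≤ P.K) : Dop P a msq * Gop P a msq = 1 := by
  rw [Gop, Dop, Module.End.mul_eq_comp, ← Matrix.toLin'_mul, deltaPrimeK_mul_G P ha hm hK, Matrix.toLin'_one,
    Module.End.one_eq_id]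

/-- `(−Δ^η + m²)f = m²f + Δf` with r03's positive Laplacian `LatticeFieldCalculus.laplace` at `c = η⁻¹`.
[cite: Balaban1984PropagatorsII, (2.13) p.225; Balaban1984PropagatorsI, (1.21) p.21; bookkeeping] -/
theorem hOp_mulVec_eq_laplace (msq : ℝ) (f : Site P 0 → ℝ) (x : Site P 0) :
    (hOp P 0 P.eps msq *ᵥ f) x = msq * f x + laplace (P.eps⁻¹) f x := by
  rw [hOp_mulVec]
  simp only [Pi.add_apply, Pi.smul_apply, smul_eq_mul, Finset.sum_apply]
  congr 1
  unfold laplace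
  refine Finset.sum_congr rfl fun μ _ => ?_
  rw [derivT_mulVec, deriv_mulVec, deriv_mulVec, smul_eq_mul, shift_unshift]
  ring

/-- `a_KQ′_K*Q′_Kf = a_K·L^{−Kd}Σ_{B(x)}f` = r03's `blockAvgOp` for the block map `blk P K`.
[cite: Balaban1984PropagatorsII, (2.13)–(2.14) p.225; bookkeeping] -/
theorem QksQk_mulVec (a : ℝ) (f : Site P 0 → ℝ) (x : Site P 0) :
    ((B1.aSeq a P.L P.K • (Qks P P.K * Qk P P.K)) *ᵥ f) x =
      blockAvgOp (blk P P.K) (B1.aSeq a P.L P.K) (wQ P P.K) f x := by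
  have hK : P.K ≤ P.m + P.K := Nat.le_add_left _ _
  rw [Matrix.smul_mulVec, Pi.smul_apply, ← Matrix.mulVec_mulVec, smul_eq_mul]
  have h1 : (Qks P P.K *ᵥ (Qk P P.K *ᵥ f)) x = (Qk P P.K *ᵥ f) (Site.proj P.K P.K x) :=
    Qks_mulVec (P := P) 0 0 hK _ x
  rw [h1]
  have h2 : (Qk P P.K *ᵥ f) (Site.proj P.K P.K x) =
      (((P.L : ℝ) ^ P.d)⁻¹) ^ P.K *
        ∑ x' ∈ Finset.univ.filter (fun x' : Site P 0 => Site.proj P.K P.K x' = Site.proj P.K P.K x), f x' :=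
    Qk_mulVec (P := P) 0 0 hK f _
  rw [h2]
  unfold blockAvgOp wQ
  rw [B1RG242Torus.lvl_of_le P hK, Finset.mul_sum]
  rfl

/-- **`Δ′_a` pointwise**: `(Δ′_af)(x) = m²f(x) + (Δf)(x) + a_KL^{−Kd}Σ_{x′∈B(x)}f(x′)` — `Δ′_a − m²` IS r03's `B6Eq239Commutator.deltaPrimeA` with
`c = η⁻¹`, the block map `blk P K`, `a = a_K`, `w = L^{−Kd}`. [cite: Balaban1984PropagatorsII, (2.13) p.225] -/
theorem Dop_apply (a msq : ℝ) (f : Site P 0 → ℝ) (x : Site P 0) :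
    Dop P a msq f x = msq * f x + deltaPrimeA (P.eps⁻¹) (blk P P.K) (B1.aSeq a P.L P.K) (wQ P P.K) f x := by
  rw [Dop_apply_eq]
  unfold deltaPrimeK deltaPrimeA
  rw [Matrix.add_mulVec, Pi.add_apply, hOp_mulVec_eq_laplace, QksQk_mulVec, add_assoc]

/-- the sup norm of a block-supported scalar test function is below its block bound. [cite: Balaban1984PropagatorsII, (2.51) p.232; bookkeeping] -/
theorem supNormV_const_le {Mb R : ℕ} {f : Site P 0 → ℝ} {y' : Site P P.K} {B : ℝ}
    (h : BlockSupp (g := B6Prop22OneScaleTorus.oneScaleGeo P Mb R) (blk P P.K) f y' B) :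
    supNormV P (fun _ : Fin P.d => f) ≤ B := by
  unfold supNormV
  refine Finset.sup'_le _ _ fun ν _ => ?_
  unfold supN
  refine Finset.sup'_le _ _ fun x _ => ?_
  show |f x| ≤ B
  by_cases hx : blk P P.K x = y'
  · exact h.bound x hx
  · rw [h.off x hx, abs_zero]; exact h.nonneg

/-- **(2.67)₁,₂ IN THE (2.51) MAJORANT CURRENCY, GENUINE, ONE SET OF CONSTANTS FOR THE FAMILY**: there are `δ₀, C > 0` (functions of `d, L, a, m²`)
such that on every member of the one-scale torus family `Index d L` (every volume, every `K ≥ 1`): `G′` has the 𝔅-majorant `C·e^{−½δ₀|y−y′|₁}`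
(`B6RandomWalk.HasMajorant`, the shape *"|(Tλ)(x)| ≤ K(y,y′)|λ|, x ∈ B^j(y), supp λ ⊂ B^{j′}(y′)"* of (2.51)), and the η-gradient obeys
`|(∂^η_μG′f)(x)| ≤ C·e^{−½δ₀|blk x − y′|₁}·B` for `f` supported in `B(y′)` with `|f| ≤ B` — Proposition 2.2's first two entries, from this seat's
gen-6 `B6Prop22OneScaleTorus.entries_oneScaleTorus`. [cite: Balaban1984PropagatorsII, Prop. 2.2 (2.67) p.234, (2.51) p.232] -/
theorem majorants_G (d L : ℕ) (hd : 1 ≤ d) (hL : Odd L ∧ 1 < L) {a : ℝ} (ha : 0 < a) {msq : ℝ} (hmsq : 0 ≤ msq) :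
    ∃ δ₀ C : ℝ, 0 < δ₀ ∧ 0 < C ∧ ∀ i : Index d L,
      HasMajorant (g := B6Prop22OneScaleTorus.oneScaleGeo i.P i.Mb i.R) (blk i.P i.P.K) (Gop i.P a msq)
          (fun y y' => C * Real.exp (-(δ₀ / 2 * T1 i.P i.P.K y y'))) ∧
      ∀ (μ : Fin i.P.d) (y' : Site i.P i.P.K) (f : Site i.P 0 → ℝ) (B : ℝ),
        BlockSupp (g := B6Prop22OneScaleTorus.oneScaleGeo i.P i.Mb i.R) (blk i.P i.P.K) f y' B →
          ∀ x, |((deriv i.P 0 i.P.eps μ * (tower i.P a msq).G i.P.K) *ᵥ f) x| ≤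
            C * Real.exp (-(δ₀ / 2 * T1 i.P i.P.K (blk i.P i.P.K x) y')) * B := by
  obtain ⟨δ₀, C, Cα, hδ₀, hC, -, h⟩ := entries_oneScaleTorus d L hd hL ha hmsq
  refine ⟨δ₀, C, hδ₀, hC, fun i => ⟨?_, ?_⟩⟩
  · intro y' f B hf x
    have hsupp : ∀ ν x, (fun _ : Fin i.P.d => f) ν x ≠ 0 → blk i.P i.P.K x = y' :=
      fun ν x hx => by_contra fun hne => hx (hf.off x hne)
    have h0 := (h i).1 0 (fun _ => f) (blk i.P i.P.K x) y' hsupp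
    rw [entryB_zero_top] at h0
    have hle := le_blockSup (P := i.P) (y := blk i.P i.P.K x) (dir0 i.P)
      (fun (μ : Fin i.P.d) (x : Site i.P 0) => ((tower i.P a msq).G i.P.K *ᵥ (fun _ : Fin i.P.d => f) μ) x) (dir0 i.P) rfl
    rw [Gop_apply_eq]
    calc |((tower i.P a msq).G i.P.K *ᵥ f) x| ≤ _ := hle
      _ ≤ C * Real.exp (-(δ₀ / 2 * T1 i.P i.P.K (blk i.P i.P.K x) y')) * supNormV i.P (fun _ : Fin i.P.d => f) := h0
      _ ≤ C * Real.exp (-(δ₀ / 2 * T1 i.P i.P.K (blk i.P i.P.K x) y')) * B :=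
          mul_le_mul_of_nonneg_left (supNormV_const_le hf) (by positivity)
  · intro μ y' f B hf x
    have hsupp : ∀ ν x, (fun _ : Fin i.P.d => f) ν x ≠ 0 → blk i.P i.P.K x = y' :=
      fun ν x hx => by_contra fun hne => hx (hf.off x hne)
    have h1 := (h i).1 1 (fun _ => f) (blk i.P i.P.K x) y' hsupp
    rw [entryB_one_top] at h1
    have hle := le_blockSup (P := i.P) (y := blk i.P i.P.K x) (dir0 i.P, dir0 i.P)
      (fun (p : Fin i.P.d × Fin i.P.d) (x : Site i.P 0) =>
        ((deriv i.P 0 i.P.eps p.1 * (tower i.P a msq).G i.P.K) *ᵥ (fun _ : Fin i.P.d => f) p.2) x) (μ, dir0 i.P) rfl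
    calc |((deriv i.P 0 i.P.eps μ * (tower i.P a msq).G i.P.K) *ᵥ f) x| ≤ _ := hle
      _ ≤ C * Real.exp (-(δ₀ / 2 * T1 i.P i.P.K (blk i.P i.P.K x) y')) * supNormV i.P (fun _ : Fin i.P.d => f) := h1
      _ ≤ C * Real.exp (-(δ₀ / 2 * T1 i.P i.P.K (blk i.P i.P.K x) y')) * B :=
          mul_le_mul_of_nonneg_left (supNormV_const_le hf) (by positivity)

end Operators


/-! ## §4  (2.39) for `Δ′_a` and the size (2.44) of `K(χ)·G′` — genuine -/

section Commutator

/-- **(2.39) for the genuine `Δ′_a`**: `(χΔ′_ag − Δ′_a(χg))(x) = Σ_μ[(∂_μχ)(x)(∂_μg)(x) + (∂χ)(⟨x−e_μ,x⟩)(∂g)(⟨x−e_μ,x⟩)] − (Δχ)(x)g(x) −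
a_KΣ_{x′∈B(x)}L^{−Kd}(χ(x′) − χ(x))g(x′)` (r03's `B6Eq239Commutator.eq239` read on `Dop`; the mass term commutes).
[cite: Balaban1984PropagatorsII, (2.39) p.229] -/
theorem comm_apply (a msq : ℝ) (χ g : Site P 0 → ℝ) (x : Site P 0) :
    ((mulOp χ * Dop P a msq - Dop P a msq * mulOp χ) g) x =
      (∑ μ : Fin P.d, (grad (P.eps⁻¹) χ ⟨x, μ⟩ * grad (P.eps⁻¹) g ⟨x, μ⟩ +
          grad (P.eps⁻¹) χ ⟨x.unshift μ, μ⟩ * grad (P.eps⁻¹) g ⟨x.unshift μ, μ⟩) - laplace (P.eps⁻¹) χ x * g x) -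
        B1.aSeq a P.L P.K * ∑ x' ∈ univ.filter (fun x' => blk P P.K x' = blk P P.K x),
          wQ P P.K * (χ x' - χ x) * g x' := by
  have hmul : mulOp χ g = χ * g := by funext y; rfl
  rw [LinearMap.sub_apply, Module.End.mul_apply, Module.End.mul_apply, hmul, Pi.sub_apply, mulOp_apply, Dop_apply, Dop_apply,
    ← eq239]
  simp only [Pi.mul_apply]
  ring

/-- the forward η-gradient of r03's calculus IS the tower's forward derivative: `(∂g)(⟨x, μ⟩) = (∂^ε_μ g)(x)`.
[cite: Balaban1984PropagatorsI, (1.4) p.18; bookkeeping] -/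
theorem grad_eq_deriv (g : Site P 0 → ℝ) (x : Site P 0) (μ : Fin P.d) :
    grad (P.eps⁻¹) g ⟨x, μ⟩ = (deriv P 0 P.eps μ *ᵥ g) x := by
  rw [LatticeFieldCalculus.grad_apply, deriv_mulVec]; rfl

/-- the backward bond: `(∂g)(⟨x − e_μ, μ⟩) = (∂^ε_μ g)(x − e_μ)`. [cite: Balaban1984PropagatorsI, (1.4) p.18; bookkeeping] -/
theorem grad_unshift_eq_deriv (g : Site P 0 → ℝ) (x : Site P 0) (μ : Fin P.d) :
    grad (P.eps⁻¹) g ⟨x.unshift μ, μ⟩ = (deriv P 0 P.eps μ *ᵥ g) (x.unshift μ) := grad_eq_deriv g _ μ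

/-- `L^{−Kd}·|B(x)| = 1`: the averaging weight times the block count. [cite: Balaban1982Higgs1, (2.11) p.609; bookkeeping] -/
theorem wQ_mul_card_block (x : Site P 0) :
    wQ P P.K * ((univ.filter fun x' : Site P 0 => blk P P.K x' = blk P P.K x).card : ℝ) = 1 := by
  have hK : P.K ≤ P.m + P.K := Nat.le_add_left _ _
  have hc : (univ.filter fun x' : Site P 0 => blk P P.K x' = blk P P.K x).card = (P.L ^ P.K) ^ P.d :=
    B1RG242Torus.card_Bj (P := P) hK (blk P P.K x)
  rw [hc]
  unfold wQ
  rw [lvl_of_le P hK]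
  push_cast
  exact B1RG242Torus.winv_pow_mul_eq_one P P.K

/-- **THE SIZE OF THE COMMUTATOR AT A POINT** («(2.43) and (2.40) imply (2.44)»): if `|g| ≤ A` on the block of `x` and at `x`, and
`|∂^ε_μg| ≤ A′` at `x` and at `x − e_μ` for every `μ`, then `|(χΔ′_ag − Δ′_a(χg))(x)| ≤ (d·D1θ/M)·A′ + (d·D2θ/(4M²) + a·d·D1θ/(2M))·A` —
the printed `O(M⁻¹)` from `|∂χ| ≤ D1θ/(2M)`, `|Δχ| ≤ dD2θ/(4M²)` (η-units, mesh-uniform) and the in-block oscillation of `χ`.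
[cite: Balaban1984PropagatorsII, (2.44) p.230, (2.39)–(2.40) pp.229–230] -/
theorem abs_comm_apply_le {a msq : ℝ} (ha : 0 < a) (hK : 1 ≤ P.K) {M : ℕ} (hM : 1 ≤ M) {c : Site P P.K} {H : ℕ}
    (hH : 7 * M + 4 ≤ 4 * H) (hN : 4 * H + 7 * M + 8 ≤ 4 * P.sitesPerDir P.K) (g : Site P 0 → ℝ) (x : Site P 0) {A A' : ℝ}
    (hg : ∀ x', blk P P.K x' = blk P P.K x → |g x'| ≤ A)
    (hdg : ∀ μ, |(deriv P 0 P.eps μ *ᵥ g) x| ≤ A' ∧ |(deriv P 0 P.eps μ *ᵥ g) (x.unshift μ)| ≤ A') :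
    |((mulOp (chiCut P c H M) * Dop P a msq - Dop P a msq * mulOp (chiCut P c H M)) g) x| ≤
      (P.d * D1 thetaProf / M) * A' + (P.d * D2 thetaProf / (4 * M ^ 2) + a * P.d * D1 thetaProf / (2 * M)) * A := by
  set χ := chiCut P c H M with hχ
  have hNχ := Nchi_pos (P := P) hM
  have hD1 := D1_nonneg contDiff_thetaProf hasCompactSupport_thetaProf
  have hD2 := D2_nonneg contDiff_thetaProf hasCompactSupport_thetaProf
  have hMR : (1 : ℝ) ≤ M := by exact_mod_cast hM
  have hLpos : (0 : ℝ) < (P.L : ℝ) ^ P.K := pow_pos P.cast_L_pos _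
  have hc : P.eps⁻¹ = (P.L : ℝ) ^ P.K := by unfold Params.eps; rw [inv_pow, inv_inv]
  have hNχ_def : Nchi P M = 2 * M * (P.L : ℝ) ^ P.K := rfl
  have hgx : |g x| ≤ A := hg x rfl
  -- sizes of the cut-off
  have hgradχ : ∀ μ, |grad (P.eps⁻¹) χ ⟨x, μ⟩| ≤ D1 thetaProf / (2 * M) := by
    intro μ
    rw [LatticeFieldCalculus.grad_apply]
    show |P.eps⁻¹ • (χ (x.shift μ) - χ x)| ≤ _
    rw [smul_eq_mul, abs_mul, hc, abs_of_pos hLpos]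
    have h := abs_chiCut_shift_sub_le hM hH hN x μ (c := c)
    rw [hNχ_def] at h
    calc (P.L : ℝ) ^ P.K * |χ (x.shift μ) - χ x| ≤ (P.L : ℝ) ^ P.K * (D1 thetaProf / (2 * M * (P.L : ℝ) ^ P.K)) :=
          mul_le_mul_of_nonneg_left h hLpos.le
      _ = D1 thetaProf / (2 * M) := by field_simp
  have hgradχ' : ∀ μ, |grad (P.eps⁻¹) χ ⟨x.unshift μ, μ⟩| ≤ D1 thetaProf / (2 * M) := by
    intro μ
    rw [LatticeFieldCalculus.grad_apply]
    show |P.eps⁻¹ • (χ ((x.unshift μ).shift μ) - χ (x.unshift μ))| ≤ _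
    rw [smul_eq_mul, abs_mul, hc, abs_of_pos hLpos]
    have h := abs_chiCut_shift_sub_le hM hH hN (x.unshift μ) μ (c := c)
    rw [hNχ_def] at h
    calc (P.L : ℝ) ^ P.K * |χ ((x.unshift μ).shift μ) - χ (x.unshift μ)|
        ≤ (P.L : ℝ) ^ P.K * (D1 thetaProf / (2 * M * (P.L : ℝ) ^ P.K)) := mul_le_mul_of_nonneg_left h hLpos.le
      _ = D1 thetaProf / (2 * M) := by field_simp
  have hlapχ : |laplace (P.eps⁻¹) χ x| ≤ P.d * D2 thetaProf / (4 * M ^ 2) := by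
    have e : laplace (P.eps⁻¹) χ x = -((P.L : ℝ) ^ P.K) ^ 2 * ∑ μ, (χ (x.shift μ) - 2 * χ x + χ (x.unshift μ)) := by
      unfold laplace; rw [hc, Finset.mul_sum]; refine Finset.sum_congr rfl fun μ _ => ?_; rw [smul_eq_mul]; ring
    rw [e, abs_mul, abs_neg, abs_of_pos (by positivity)]
    have h := abs_sum_chiCut_second_diff_le hM hH hN x (c := c)
    rw [hNχ_def] at h
    calc ((P.L : ℝ) ^ P.K) ^ 2 * |∑ μ, (χ (x.shift μ) - 2 * χ x + χ (x.unshift μ))|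
        ≤ ((P.L : ℝ) ^ P.K) ^ 2 * (P.d * (D2 thetaProf / (2 * M * (P.L : ℝ) ^ P.K) ^ 2)) := mul_le_mul_of_nonneg_left h (by positivity)
      _ = P.d * D2 thetaProf / (4 * M ^ 2) := by field_simp; ring
  have hoscχ : ∀ x', blk P P.K x' = blk P P.K x → |χ x' - χ x| ≤ P.d * D1 thetaProf / (2 * M) := by
    intro x' hx'
    have h := abs_chiCut_sub_le_of_blk_eq hM c H hx' (P := P)
    rw [hNχ_def] at h
    refine h.trans ?_
    have h1 : ((P.L : ℝ) ^ P.K - 1) / (2 * M * (P.L : ℝ) ^ P.K) ≤ 1 / (2 * M) := by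
      rw [div_le_div_iff₀ (by positivity) (by positivity)]; nlinarith
    calc P.d * (D1 thetaProf * (((P.L : ℝ) ^ P.K - 1) / (2 * M * (P.L : ℝ) ^ P.K)))
        ≤ P.d * (D1 thetaProf * (1 / (2 * M))) := by gcongr
      _ = P.d * D1 thetaProf / (2 * M) := by ring
  -- the three terms
  rw [comm_apply]
  have hT1 : |∑ μ : Fin P.d, (grad (P.eps⁻¹) χ ⟨x, μ⟩ * grad (P.eps⁻¹) g ⟨x, μ⟩ +
      grad (P.eps⁻¹) χ ⟨x.unshift μ, μ⟩ * grad (P.eps⁻¹) g ⟨x.unshift μ, μ⟩)| ≤ P.d * D1 thetaProf / M * A' := by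
    calc |∑ μ : Fin P.d, (grad (P.eps⁻¹) χ ⟨x, μ⟩ * grad (P.eps⁻¹) g ⟨x, μ⟩ +
            grad (P.eps⁻¹) χ ⟨x.unshift μ, μ⟩ * grad (P.eps⁻¹) g ⟨x.unshift μ, μ⟩)|
        ≤ ∑ μ : Fin P.d, |grad (P.eps⁻¹) χ ⟨x, μ⟩ * grad (P.eps⁻¹) g ⟨x, μ⟩ +
            grad (P.eps⁻¹) χ ⟨x.unshift μ, μ⟩ * grad (P.eps⁻¹) g ⟨x.unshift μ, μ⟩| := Finset.abs_sum_le_sum_abs _ _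
      _ ≤ ∑ _μ : Fin P.d, (D1 thetaProf / (2 * M) * A' + D1 thetaProf / (2 * M) * A') := by
          refine Finset.sum_le_sum fun μ _ => (abs_add_le _ _).trans (add_le_add ?_ ?_)
          · rw [abs_mul, grad_eq_deriv g x μ]
            exact mul_le_mul (hgradχ μ) (hdg μ).1 (abs_nonneg _) (by positivity)
          · rw [abs_mul, grad_unshift_eq_deriv g x μ]
            exact mul_le_mul (hgradχ' μ) (hdg μ).2 (abs_nonneg _) (by positivity)
      _ = P.d * D1 thetaProf / M * A' := by
          rw [Finset.sum_const, Finset.card_univ, Fintype.card_fin, nsmul_eq_mul]; field_simp; ring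
  have hT2 : |laplace (P.eps⁻¹) χ x * g x| ≤ P.d * D2 thetaProf / (4 * M ^ 2) * A := by
    rw [abs_mul]; exact mul_le_mul hlapχ hgx (abs_nonneg _) (by positivity)
  have hT3 : |B1.aSeq a P.L P.K * ∑ x' ∈ univ.filter (fun x' => blk P P.K x' = blk P P.K x),
      wQ P P.K * (χ x' - χ x) * g x'| ≤ a * P.d * D1 thetaProf / (2 * M) * A := by
    have haK := B1.aSeq_le ha (B1RG242Torus.one_lt_cast_L P) P.K hK
    have haK0 := (B1.aSeq_pos ha (B1RG242Torus.one_lt_cast_L P) hK).le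
    have hw := (wQ_pos P P.K).le
    rw [abs_mul, abs_of_nonneg haK0]
    have hsum : |∑ x' ∈ univ.filter (fun x' => blk P P.K x' = blk P P.K x), wQ P P.K * (χ x' - χ x) * g x'| ≤
        P.d * D1 thetaProf / (2 * M) * A := by
      calc |∑ x' ∈ univ.filter (fun x' => blk P P.K x' = blk P P.K x), wQ P P.K * (χ x' - χ x) * g x'|
          ≤ ∑ x' ∈ univ.filter (fun x' => blk P P.K x' = blk P P.K x), |wQ P P.K * (χ x' - χ x) * g x'| :=
            Finset.abs_sum_le_sum_abs _ _
        _ ≤ ∑ x' ∈ univ.filter (fun x' => blk P P.K x' = blk P P.K x), wQ P P.K * (P.d * D1 thetaProf / (2 * M) * A) := by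
            refine Finset.sum_le_sum fun x' hx' => ?_
            have hb := (Finset.mem_filter.mp hx').2
            rw [abs_mul, abs_mul, abs_of_nonneg hw, mul_assoc]
            exact mul_le_mul_of_nonneg_left (mul_le_mul (hoscχ x' hb) (hg x' hb) (abs_nonneg _) (by positivity)) hw
        _ = P.d * D1 thetaProf / (2 * M) * A := by
            rw [Finset.sum_const, nsmul_eq_mul, ← mul_assoc, mul_comm ((univ.filter _).card : ℝ), wQ_mul_card_block, one_mul]
    calc B1.aSeq a P.L P.K * |∑ x' ∈ univ.filter (fun x' => blk P P.K x' = blk P P.K x), wQ P P.K * (χ x' - χ x) * g x'|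
        ≤ a * (P.d * D1 thetaProf / (2 * M) * A) := mul_le_mul haK hsum (abs_nonneg _) ha.le
      _ = a * P.d * D1 thetaProf / (2 * M) * A := by ring
  calc |(∑ μ : Fin P.d, (grad (P.eps⁻¹) χ ⟨x, μ⟩ * grad (P.eps⁻¹) g ⟨x, μ⟩ +
            grad (P.eps⁻¹) χ ⟨x.unshift μ, μ⟩ * grad (P.eps⁻¹) g ⟨x.unshift μ, μ⟩) - laplace (P.eps⁻¹) χ x * g x) -
          B1.aSeq a P.L P.K * ∑ x' ∈ univ.filter (fun x' => blk P P.K x' = blk P P.K x), wQ P P.K * (χ x' - χ x) * g x'|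
      ≤ |∑ μ : Fin P.d, (grad (P.eps⁻¹) χ ⟨x, μ⟩ * grad (P.eps⁻¹) g ⟨x, μ⟩ +
            grad (P.eps⁻¹) χ ⟨x.unshift μ, μ⟩ * grad (P.eps⁻¹) g ⟨x.unshift μ, μ⟩)| + |laplace (P.eps⁻¹) χ x * g x| +
          |B1.aSeq a P.L P.K * ∑ x' ∈ univ.filter (fun x' => blk P P.K x' = blk P P.K x), wQ P P.K * (χ x' - χ x) * g x'| := by
        refine (abs_sub _ _).trans (add_le_add (abs_sub _ _) le_rfl)
    _ ≤ P.d * D1 thetaProf / M * A' + P.d * D2 thetaProf / (4 * M ^ 2) * A + a * P.d * D1 thetaProf / (2 * M) * A :=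
        add_le_add (add_le_add hT1 hT2) hT3
    _ = (P.d * D1 thetaProf / M) * A' + (P.d * D2 thetaProf / (4 * M ^ 2) + a * P.d * D1 thetaProf / (2 * M)) * A := by ring

/-- **THE COMMUTATOR VANISHES ON THE CORE**: if the block of `x` is a core block (χ = 1 on it and next to it) then `(χΔ′_ag − Δ′_a(χg))(x) = 0`.
[cite: Balaban1984PropagatorsII, (2.39) p.229; bookkeeping] -/
theorem comm_apply_eq_zero_of_core {a msq : ℝ} {M : ℕ} (hM : 1 ≤ M) {c : Site P P.K} {H : ℕ} (hH : 7 * M + 4 ≤ 4 * H)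
    (hN : 4 * H + 7 * M + 8 ≤ 4 * P.sitesPerDir P.K) (g : Site P 0 → ℝ) {x : Site P 0} (hx : blk P P.K x ∈ Core P c H M) :
    ((mulOp (chiCut P c H M) * Dop P a msq - Dop P a msq * mulOp (chiCut P c H M)) g) x = 0 := by
  have h1 := chiCut_eq_one_near_core hM hH hN hx
  rw [comm_apply]
  have hgrad : ∀ μ, grad (P.eps⁻¹) (chiCut P c H M) ⟨x, μ⟩ = 0 := by
    intro μ; rw [LatticeFieldCalculus.grad_apply]; show P.eps⁻¹ • (chiCut P c H M (x.shift μ) - chiCut P c H M x) = 0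
    rw [(h1.2 μ).1, h1.1, sub_self, smul_zero]
  have hgrad' : ∀ μ, grad (P.eps⁻¹) (chiCut P c H M) ⟨x.unshift μ, μ⟩ = 0 := by
    intro μ; rw [LatticeFieldCalculus.grad_apply]
    show P.eps⁻¹ • (chiCut P c H M ((x.unshift μ).shift μ) - chiCut P c H M (x.unshift μ)) = 0
    rw [shift_unshift, (h1.2 μ).2, h1.1, sub_self, smul_zero]
  have hlap : laplace (P.eps⁻¹) (chiCut P c H M) x = 0 := by
    unfold laplace
    refine Finset.sum_eq_zero fun μ _ => ?_
    rw [(h1.2 μ).1, (h1.2 μ).2, h1.1]; simp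
  have hblk : ∀ x' ∈ univ.filter (fun x' => blk P P.K x' = blk P P.K x),
      wQ P P.K * (chiCut P c H M x' - chiCut P c H M x) * g x' = 0 := by
    intro x' hx'
    have hb := (Finset.mem_filter.mp hx').2
    have hx'' : blk P P.K x' ∈ Core P c H M := hb ▸ hx
    rw [(chiCut_eq_one_near_core hM hH hN hx'').1, h1.1, sub_self, mul_zero, zero_mul]
  simp only [hgrad, hgrad', hlap, zero_mul, add_zero, Finset.sum_const_zero, Finset.sum_eq_zero hblk, mul_zero, sub_zero]

/-- the commutator vanishes at `x` when the cut-off vanishes on the block of `x` and at the nearest neighbours of `x` (far outside the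
support of `χ` both `χΔ′_ag` and `Δ′_a(χg)` vanish at `x`). [cite: Balaban1984PropagatorsII, (2.39) p.229; bookkeeping] -/
theorem comm_apply_eq_zero_of_vanish (a msq : ℝ) {χ : Site P 0 → ℝ} (g : Site P 0 → ℝ) {x : Site P 0}
    (hb : ∀ x', blk P P.K x' = blk P P.K x → χ x' = 0) (hn : ∀ μ, χ (x.shift μ) = 0 ∧ χ (x.unshift μ) = 0) :
    ((mulOp χ * Dop P a msq - Dop P a msq * mulOp χ) g) x = 0 := by
  have h0 : χ x = 0 := hb x rfl
  rw [comm_apply]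
  have hgrad : ∀ μ, grad (P.eps⁻¹) χ ⟨x, μ⟩ = 0 := by
    intro μ; rw [LatticeFieldCalculus.grad_apply]; show P.eps⁻¹ • (χ (x.shift μ) - χ x) = 0
    rw [(hn μ).1, h0, sub_self, smul_zero]
  have hgrad' : ∀ μ, grad (P.eps⁻¹) χ ⟨x.unshift μ, μ⟩ = 0 := by
    intro μ; rw [LatticeFieldCalculus.grad_apply]
    show P.eps⁻¹ • (χ ((x.unshift μ).shift μ) - χ (x.unshift μ)) = 0
    rw [shift_unshift, (hn μ).2, h0, sub_self, smul_zero]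
  have hlap : laplace (P.eps⁻¹) χ x = 0 := by
    unfold laplace
    refine Finset.sum_eq_zero fun μ _ => ?_
    rw [(hn μ).1, (hn μ).2, h0]; simp
  have hblk : ∀ x' ∈ univ.filter (fun x' => blk P P.K x' = blk P P.K x), wQ P P.K * (χ x' - χ x) * g x' = 0 := by
    intro x' hx'
    rw [hb x' (Finset.mem_filter.mp hx').2, h0, sub_self, mul_zero, zero_mul]
  simp only [hgrad, hgrad', hlap, zero_mul, add_zero, Finset.sum_const_zero, Finset.sum_eq_zero hblk, mul_zero, sub_zero]

/-- **the zone constant** `θ₀ = C·e^{δ₀/2}·(d·D1θ + d·D2θ/4 + a·d·D1θ/2) + 1` of the `O(M⁻¹)` majorant of `K(χ)G′` (from the majorant constant `C`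
and rate `δ₀` of `G′` and the profile sizes). [cite: Balaban1984PropagatorsII, (2.44) p.230; bookkeeping] -/
def theta0 (d : ℕ) (a C δ₀ : ℝ) : ℝ :=
  C * Real.exp (δ₀ / 2) * (d * D1 thetaProf + d * D2 thetaProf / 4 + a * d * D1 thetaProf / 2) + 1

/-- `θ₀ > 0`. [cite: Balaban1984PropagatorsII, (2.44) p.230; bookkeeping] -/
theorem theta0_pos (d : ℕ) {a C : ℝ} (ha : 0 ≤ a) (hC : 0 ≤ C) (δ₀ : ℝ) : 0 < theta0 d a C δ₀ := by
  have hD1 := D1_nonneg contDiff_thetaProf hasCompactSupport_thetaProf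
  have hD2 := D2_nonneg contDiff_thetaProf hasCompactSupport_thetaProf
  unfold theta0
  positivity

/-- **from local bounds to the zone bound**: if `|g| ≤ Ce^{δ₀/2}·E·B` on the block of `x` and `|∂^ε_μg| ≤ Ce^{δ₀/2}·E·B` at `x`, `x − e_μ`, then
`|(χΔ′_ag − Δ′_a(χg))(x)| ≤ (θ₀/M)·E·B`. [cite: Balaban1984PropagatorsII, (2.44) p.230] -/
theorem abs_comm_apply_le_theta0 {d : ℕ} (hPd : P.d = d) {a msq : ℝ} (ha : 0 < a) (hK : 1 ≤ P.K) {M : ℕ} (hM : 1 ≤ M)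
    {c : Site P P.K} {H : ℕ} (hH : 7 * M + 4 ≤ 4 * H) (hN : 4 * H + 7 * M + 8 ≤ 4 * P.sitesPerDir P.K) (g : Site P 0 → ℝ)
    (x : Site P 0) {C δ₀ E B : ℝ} (hC : 0 ≤ C) (hE : 0 ≤ E) (hB : 0 ≤ B)
    (hA : ∀ x', blk P P.K x' = blk P P.K x → |g x'| ≤ C * Real.exp (δ₀ / 2) * E * B)
    (hA' : ∀ μ, |(deriv P 0 P.eps μ *ᵥ g) x| ≤ C * Real.exp (δ₀ / 2) * E * B ∧
      |(deriv P 0 P.eps μ *ᵥ g) (x.unshift μ)| ≤ C * Real.exp (δ₀ / 2) * E * B) :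
    |((mulOp (chiCut P c H M) * Dop P a msq - Dop P a msq * mulOp (chiCut P c H M)) g) x| ≤
      theta0 d a C δ₀ / M * E * B := by
  have hD1 := D1_nonneg contDiff_thetaProf hasCompactSupport_thetaProf
  have hD2 := D2_nonneg contDiff_thetaProf hasCompactSupport_thetaProf
  have hMR : (1 : ℝ) ≤ M := by exact_mod_cast hM
  have hPd' : (P.d : ℝ) = d := by exact_mod_cast hPd
  have hmain := abs_comm_apply_le (msq := msq) (c := c) ha hK hM hH hN g x hA hA'
  refine hmain.trans ?_
  have hM2 : (1 : ℝ) / M ^ 2 ≤ 1 / M := by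
    rw [div_le_div_iff₀ (by positivity) (by positivity)]; nlinarith
  have hX : 0 ≤ C * Real.exp (δ₀ / 2) * E * B := by positivity
  calc (P.d * D1 thetaProf / M) * (C * Real.exp (δ₀ / 2) * E * B) +
        (P.d * D2 thetaProf / (4 * M ^ 2) + a * P.d * D1 thetaProf / (2 * M)) * (C * Real.exp (δ₀ / 2) * E * B)
      = (C * Real.exp (δ₀ / 2) * (d * D1 thetaProf + a * d * D1 thetaProf / 2) * (1 / M) +
          C * Real.exp (δ₀ / 2) * (d * D2 thetaProf / 4) * (1 / M ^ 2)) * E * B := by rw [hPd']; ring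
    _ ≤ (C * Real.exp (δ₀ / 2) * (d * D1 thetaProf + a * d * D1 thetaProf / 2) * (1 / M) +
          C * Real.exp (δ₀ / 2) * (d * D2 thetaProf / 4) * (1 / M)) * E * B := by gcongr
    _ = (C * Real.exp (δ₀ / 2) * (d * D1 thetaProf + d * D2 thetaProf / 4 + a * d * D1 thetaProf / 2)) / M * E * B := by ring
    _ ≤ theta0 d a C δ₀ / M * E * B := by unfold theta0; gcongr; linarith

/-- **(2.44) GENUINE, IN THE (2.51) MAJORANT CURRENCY — the located inputs `hG`, `hKG` of the p. 238 change-of-domain chain for the genuine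
operators.**  There are `δ₀, C > 0` (functions of `d, L, a, m²`) such that on EVERY member of the one-scale torus family
(every volume, every `K ≥ 1`): (i) `G′` has the 𝔅-majorant `C·e^{−½δ₀|y−y′|₁}` and the gradient bound of `majorants_G`; (ii) for every centre
chart `(c, H)` and cube radius `M ≥ 1` with the chart hypotheses, the commutator product `(χΔ′_a − Δ′_aχ)·G′` has the ZONE majorant
`1_N(y)·(θ₀/M)·e^{−½δ₀|y−y′|₁}`, `θ₀ = theta0 d a C δ₀`, `N` = the complement of the core — *"|(K(h_□)G′(□)h_□λ)(x)| ≤ O(M^{−1})e^{−δ₀|x−y|}|λ|"* for the global `G′`.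
[cite: Balaban1984PropagatorsII, (2.44) p.230, p.238 («An estimate of the terms with the commutator … gives a factor O(M⁻¹)»)] -/
theorem hasMajorant_comm_G (d L : ℕ) (hd : 1 ≤ d) (hL : Odd L ∧ 1 < L) {a : ℝ} (ha : 0 < a) {msq : ℝ} (hmsq : 0 ≤ msq) :
    ∃ δ₀ C : ℝ, 0 < δ₀ ∧ 0 < C ∧ ∀ i : Index d L,
      HasMajorant (g := B6Prop22OneScaleTorus.oneScaleGeo i.P i.Mb i.R) (blk i.P i.P.K) (Gop i.P a msq)
          (fun y y' => C * Real.exp (-(δ₀ / 2 * T1 i.P i.P.K y y'))) ∧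
      (∀ (μ : Fin i.P.d) (y' : Site i.P i.P.K) (f : Site i.P 0 → ℝ) (B : ℝ),
        BlockSupp (g := B6Prop22OneScaleTorus.oneScaleGeo i.P i.Mb i.R) (blk i.P i.P.K) f y' B →
          ∀ x, |((deriv i.P 0 i.P.eps μ * (tower i.P a msq).G i.P.K) *ᵥ f) x| ≤
            C * Real.exp (-(δ₀ / 2 * T1 i.P i.P.K (blk i.P i.P.K x) y')) * B) ∧
      ∀ (c : Site i.P i.P.K) (H M : ℕ), 1 ≤ M → 7 * M + 4 ≤ 4 * H → 4 * H + 7 * M + 8 ≤ 4 * i.P.sitesPerDir i.P.K →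
        HasMajorant (g := B6Prop22OneScaleTorus.oneScaleGeo i.P i.Mb i.R) (blk i.P i.P.K)
          ((mulOp (chiCut i.P c H M) * Dop i.P a msq - Dop i.P a msq * mulOp (chiCut i.P c H M)) * Gop i.P a msq)
          (fun y y' => (if y ∈ Finset.univ \ Core i.P c H M then theta0 d a C δ₀ / M else 0) *
            Real.exp (-(δ₀ / 2 * T1 i.P i.P.K y y'))) := by
  obtain ⟨δ₀, C, hδ₀, hC, h⟩ := majorants_G d L hd hL ha hmsq
  have hθ₀pos : 0 < theta0 d a C δ₀ := theta0_pos d ha.le hC.le δ₀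
  refine ⟨δ₀, C, hδ₀, hC, fun i => ⟨(h i).1, (h i).2, fun c H M hM hH hN => ?_⟩⟩
  intro y' f B hf x
  beta_reduce
  have hB : 0 ≤ B := hf.nonneg
  set E := Real.exp (-(δ₀ / 2 * T1 i.P i.P.K (blk i.P i.P.K x) y')) with hE
  rw [Module.End.mul_apply]
  by_cases hx : blk i.P i.P.K x ∈ Core i.P c H M
  · rw [comm_apply_eq_zero_of_core hM hH hN _ hx, abs_zero]
    have : 0 ≤ (if blk i.P i.P.K x ∈ Finset.univ \ Core i.P c H M then theta0 d a C δ₀ / M else 0) :=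
      by split_ifs <;> positivity
    positivity
  · have hxN : blk i.P i.P.K x ∈ Finset.univ \ Core i.P c H M := Finset.mem_sdiff.mpr ⟨Finset.mem_univ _, hx⟩
    rw [if_pos hxN]
    set g := Gop i.P a msq f with hg
    have hge : ∀ z, g z = ((tower i.P a msq).G i.P.K *ᵥ f) z := fun z => by rw [hg, Gop_apply_eq]
    have hexp1 : (1 : ℝ) ≤ Real.exp (δ₀ / 2) := Real.one_le_exp (by positivity)
    -- the local sup and gradient bounds A = A′ = C e^{δ₀/2} E B
    have hA : ∀ x', blk i.P i.P.K x' = blk i.P i.P.K x → |g x'| ≤ C * Real.exp (δ₀ / 2) * E * B := by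
      intro x' hx'
      have h0 := (h i).1 y' f B hf x'
      rw [hx'] at h0
      rw [hge]
      rw [Gop_apply_eq] at h0
      calc |((tower i.P a msq).G i.P.K *ᵥ f) x'| ≤ C * E * B := h0
        _ ≤ C * Real.exp (δ₀ / 2) * E * B := by
            have : C * E * B = C * 1 * E * B := by ring
            rw [this]; gcongr
    have hA' : ∀ μ, |(deriv i.P 0 i.P.eps μ *ᵥ g) x| ≤ C * Real.exp (δ₀ / 2) * E * B ∧
        |(deriv i.P 0 i.P.eps μ *ᵥ g) (x.unshift μ)| ≤ C * Real.exp (δ₀ / 2) * E * B := by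
      intro μ
      have hgf : g = (tower i.P a msq).G i.P.K *ᵥ f := funext hge
      rw [hgf, Matrix.mulVec_mulVec]
      constructor
      · calc |((deriv i.P 0 i.P.eps μ * (tower i.P a msq).G i.P.K) *ᵥ f) x| ≤ C * E * B := (h i).2 μ y' f B hf x
          _ ≤ C * Real.exp (δ₀ / 2) * E * B := by
              have : C * E * B = C * 1 * E * B := by ring
              rw [this]; gcongr
      · calc |((deriv i.P 0 i.P.eps μ * (tower i.P a msq).G i.P.K) *ᵥ f) (x.unshift μ)|
            ≤ C * Real.exp (-(δ₀ / 2 * T1 i.P i.P.K (blk i.P i.P.K (x.unshift μ)) y')) * B := (h i).2 μ y' f B hf _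
          _ ≤ C * (Real.exp (δ₀ / 2) * E) * B := by
              gcongr
              exact exp_T1_unshift_le (by positivity) x μ y'
          _ = C * Real.exp (δ₀ / 2) * E * B := by ring
    have hmain := abs_comm_apply_le_theta0 (msq := msq) (c := c) i.hPd ha i.hK hM hH hN g x hC.le (by positivity) hB hA hA'
    rw [hE] at hmain
    exact hmain

/-- **non-vacuity of the chart hypotheses**: with `M ≥ 1`, `H = 2M + 1`… rather for any `H` with `7M + 4 ≤ 4H` and a volume with
`4H + 7M + 8 ≤ 4N_K` the statements above apply; e.g. `H = 2M`, `N_K = 2L^m ≥ 4M + 2` — recorded by the sibling transplant file where the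
charts are instantiated. Here: the core is non-empty for `M ≥ 1` (it contains the centre `y` with `woff(y) = (H,…,H)` when such a site exists),
and the zone is non-empty as soon as the torus has a site outside the core. [cite: Balaban1984PropagatorsII, p.235; bookkeeping] -/
theorem core_mem_of_woff_eq {M : ℕ} (hM : 1 ≤ M) {c : Site P P.K} {H : ℕ} {y : Site P P.K} (hy : ∀ μ, woff P P.K c y μ = H) :
    y ∈ Core P c H M := by
  refine Finset.mem_filter.mpr ⟨Finset.mem_univ _, fun μ => ?_⟩
  rw [hy μ]; simp; omega

end Commutator


end

end Literature.MathematicalPhysics.QuantumFieldTheory.Balaban1983to89.B6Commutator244TowerTorus
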